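import Summits.NavierStokesRegularity.NavierStokesRegularity.Theorems.RootDecompLiouvilleHorizonHorizonCompactnessTools
import Literature.Analysis.FluidPDE.AncientMildCompactness
import Literature.Analysis.FluidPDE.KNSSTypeIRateLiouvilleMild
import Summits.NavierStokesRegularity.NavierStokesRegularity.Theses.RootDecompLiouvilleHorizon
import HarnessLib

/-!
# Route `RootDecompLiouvilleHorizon`, support CPT `HorizonCompactness` (item stmt-NavierStokesRegularity-32320):
# the compactness half of the horizon ladder — PROVED

`HorizonCompactness` (CPT, the EXPECTED THEOREM of the node `NavierStokesRegularity ⟸ BlowupHorizon ∧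
TypeIGradientFloor ∧ NoRecordEulerianTypeII`, feeding `ClayHorizon ⟸ TypeIliouvilleL ∧ HorizonCompactness` and
`RecordZoomBridge ⟸ HorizonCompactness`): fix `ε > 0`; if for every window length `S > 0` there is a Clay-class
solution (classical on `[0, T)`, Leray–Hopf from its rapidly decaying datum) bounded by `M` on `(0, t] × ℝ³`,
`0 < t < T`, with `S ν ≤ M² t` and a point `y` with `ν‖∇u(t)(y)‖ > ε M²`, then there is a bounded ancient mild
solution `W` (unit viscosity) with strongly measurable slices one of which is NOT a.e. constant — a witness against
the Liouville conjecture (L).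

Proof (Koch–Nadirashvili–Seregin–Šverák 2009, the compactness step of Thm 6.2, run on the GRADIENT): take
`S = k + 4` and normalise about the gradient witness — `v_k(s, z) = M_k⁻¹ u_k(t_k + (ν_k/M_k²)s, y_k + (ν_k/M_k)z)`
is continuous, weakly divergence free, Oseen-mild and bounded by `1` on `(−t_k M_k²/ν_k, 0) ⊇ (−(k+4), 0)`
(`zoomN_window`), with `‖∇v_k(0)(0)‖ = (ν_k/M_k²)‖∇u_k(t_k)(y_k)‖ > ε` (`zoomN_norm_fderiv_centre`). The uniform
end-of-window bounds (`exists_uniform_end_bounds`: KNSS (4.10)–(4.11) applied to time translates) give `K, L` with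
`‖D²v_k(σ)‖ ≤ K` and `‖∇v_k(σ)(x) − ∇v_k(σ')(x)‖ ≤ L|σ − σ'|` on `[−1, 0)`; as `v_k` is classical about `σ = 0`
(an interior time of `u_k`; `zoomN_continuousAt_fderiv`) the Lipschitz bound reaches `σ' = 0`, so at the FIXED
interior time `σ₀ = −min(½, ε/(4(L+1)))` the floor survives, `‖∇v_k(σ₀)(0)‖ > ε/2`; a unit direction `e_k` of
near-maximal stretch and the first-order Taylor lower bound turn it into the oscillation floor
`‖v_k(σ₀, h e_k) − v_k(σ₀, 0)‖ ≥ hε/4`, `h = min(1, ε/(4(K+1)))`, UNIFORM in `k`. Along a subsequence `e_k → e`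
(compact unit sphere); extracting with KNSS Lemma 6.1 (`KNSS2009_lemma61_oseenMild`: pointwise AND slice-locally-
uniform convergence on `t < 0`) gives a bounded ancient mild solution `W` (`isBoundedAncientMildSolution_of_oseen`)
with continuous slices and `‖W(σ₀, h e) − W(σ₀, 0)‖ ≥ hε/4 > 0`, so `W(σ₀)` is not a.e. constant
(`Continuous.ae_eq_iff_eq`).

Main result: `horizonCompactness_proof : Theses.RootDecompLiouvilleHorizon.HorizonCompactness` (the item, by
name). Def-free; axioms ⊆ {propext, Classical.choice, Quot.sound}. Tools:
`Theorems/RootDecompLiouvilleHorizonHorizonCompactnessTools.lean`.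

Sources: [KochNadirashviliSereginSverak2009] arXiv:0709.3599 §4 (4.10)–(4.11), §6 (Lemma 6.1, proof of Thm 6.2);
Seregin 2014 lecture notes p. 113. Lens provenance: decomp-ns lens 5, gen 22 (HOME/decomp-ns-lens-5/NODE-g22.md §4a).
-/

set_option linter.dupNamespace false

noncomputable section

open MeasureTheory Set Function Filter TopologicalSpace Metric
open scoped Topology ContDiff

namespace Summit.NavierStokesRegularity.NavierStokesRegularity.Theorems.RootDecompLiouvilleHorizonHorizonCompactness

open Literature.Analysis Literature.Analysis.FluidPDE
open Summit.NavierStokesRegularity.NavierStokesRegularity.Theorems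
open Summit.NavierStokesRegularity.NavierStokesRegularity.Theorems.RootDecompLiouvilleHorizonHorizonCompactnessTools

/-! ### D. The item -/

/-- **CPT `HorizonCompactness` (item stmt-NavierStokesRegularity-32320) — PROVED.** If, for one
`ε > 0`, the horizon rung `H(ε)` fails on windows of every length `S` (Clay-class solutions `u_S`
bounded by `M_S` on `(0, t_S]` with `S ν_S ≤ M_S² t_S` and a point where `ν_S‖∇u_S(t_S)‖ > ε M_S²`),
then there is a bounded ancient mild solution (`ν = 1`) with measurable slices one of which is not
a.e. constant. Proof: normalise (`M = ν = 1`, centre = the gradient witness), read the gradient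
floor `‖∇v_k(0)(0)‖ > ε` at an interior time `σ₀ < 0` through the uniform time-Lipschitz bound of
the gradient (KNSS (4.11)) and turn it into an oscillation floor `‖v_k(σ₀, h e_k) − v_k(σ₀, 0)‖ ≥ η`
through the uniform `C²` bound (KNSS (4.10)); extract with KNSS Lemma 6.1
(`KNSS2009_lemma61_oseenMild`, pointwise and slice-locally-uniform convergence) along a subsequence
with convergent directions `e_k → e`; the limit is a bounded ancient mild solution
(`isBoundedAncientMildSolution_of_oseen`) with continuous slices and
`W(σ₀, h e) ≠ W(σ₀, 0)`. [cite: KochNadirashviliSereginSverak2009, Lemma 6.1, §4 (4.10)–(4.11), proof of Thm 6.2 (arXiv:0709.3599 pp. 8, 11, 13); Seregin2014 p. 113] -/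
theorem horizonCompactness_proof :
    Summit.NavierStokesRegularity.NavierStokesRegularity.Theses.RootDecompLiouvilleHorizon.HorizonCompactness := by
  intro ε hε H
  choose ν T hν hT u p hsol hLH hdec t ht M hS hbd y hgrad using
    fun k : ℕ => H ((k : ℝ) + 4) (by positivity)
  -- `M_k > 0`
  have hM : ∀ k, 0 < M k := fun k => by
    have hM0 : 0 ≤ M k := (norm_nonneg _).trans (hbd k (t k) ⟨(ht k).1, le_rfl⟩ (y k))
    rcases hM0.eq_or_lt with h0 | hpos
    · exfalso
      have hu0 : u k (t k) = fun _ => 0 := funext fun z => by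
        have hz := hbd k (t k) ⟨(ht k).1, le_rfl⟩ z
        rw [← h0] at hz
        exact norm_le_zero_iff.1 hz
      have h' := hgrad k
      rw [hu0] at h'
      simp at h'
      nlinarith [sq_nonneg (M k), h']
    · exact hpos
  -- the scales of the normalisation
  set R : ℕ → ℝ := fun k => ν k / M k with hRdef
  set α : ℕ → ℝ := fun k => R k / ν k with hαdef
  set β : ℕ → ℝ := fun k => R k ^ 2 / ν k with hβdef
  have hβν : ∀ k, β k = ν k / M k ^ 2 := fun k => by
    simp only [hβdef, hRdef]
    field_simp
  have hβ0 : ∀ k, 0 < β k := fun k => by rw [hβν]; exact div_pos (hν k) (pow_pos (hM k) 2)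
  -- the normalised zooms and their windows `(A_k, 0)`, `A_k ≤ -(k + 4)`
  set v : ℕ → ℝ → EuclideanSpace ℝ (Fin 3) → EuclideanSpace ℝ (Fin 3) :=
    fun k => α k • stPull (β k) (R k) (t k) (y k) (u k) with hvdef
  set A : ℕ → ℝ := fun k => -(t k / β k) with hAdef
  have hAk : ∀ k, A k ≤ -((k : ℝ) + 4) := fun k => by
    have h1 : ((k : ℝ) + 4) * β k ≤ t k := by
      rw [hβν]
      calc ((k : ℝ) + 4) * (ν k / M k ^ 2) = ((k : ℝ) + 4) * ν k / M k ^ 2 := by ring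
        _ ≤ M k ^ 2 * t k / M k ^ 2 := div_le_div_of_nonneg_right (hS k) (by positivity)
        _ = t k := mul_div_cancel_left₀ (t k) (pow_ne_zero 2 (hM k).ne')
    have h2 : (k : ℝ) + 4 ≤ t k / β k := by rwa [le_div_iff₀ (hβ0 k)]
    simp only [hAdef]
    linarith
  have hA4 : ∀ k, A k ≤ -4 := fun k => (hAk k).trans (by
    have : (0 : ℝ) ≤ k := Nat.cast_nonneg k
    linarith)
  have hAlim : Tendsto A atTop atBot := by
    have h1 : Tendsto (fun k : ℕ => -((k : ℝ) + 4)) atTop atBot :=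
      tendsto_neg_atTop_atBot.comp (tendsto_natCast_atTop_atTop.atTop_add tendsto_const_nhds)
    exact tendsto_atBot_mono hAk h1
  -- the window facts
  have hW : ∀ k, ContinuousOn (uncurry (v k)) (Ioo (A k) 0 ×ˢ univ) ∧
      (∀ s ∈ Ioo (A k) 0, IsWeaklyDivFree (v k s)) ∧
      (∀ σ τ : ℝ, A k < σ → σ < τ → τ < 0 → ∀ z,
        v k τ z = UnboundedOperators.heatExtension (v k σ) (τ - σ) z -
          oseenDuhamel 1 σ (v k) (v k) τ z) ∧
      (∀ s ∈ Ioo (A k) 0, ∀ z, ‖v k s z‖ ≤ 1) := fun k =>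
    zoomN_window (y := y k) (hν k) (hsol k) (hLH k) (hdec k) (ht k) (hM k) (hbd k) rfl rfl rfl
  -- uniform bounds near the end of the windows
  obtain ⟨K, L, hK0, hL0, hKL⟩ := exists_uniform_end_bounds
  have hD2 : ∀ k, ∀ σ ∈ Ico (-1 : ℝ) 0, ∀ x, ‖iteratedFDeriv ℝ 2 (v k σ) x‖ ≤ K := fun k =>
    (hKL (hA4 k) (hW k).1 (hW k).2.1 (hW k).2.2.1 (hW k).2.2.2).1
  have hLip : ∀ k, ∀ σ ∈ Ico (-1 : ℝ) 0, ∀ σ' ∈ Ico (-1 : ℝ) 0, ∀ x,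
      ‖fderiv ℝ (v k σ) x - fderiv ℝ (v k σ') x‖ ≤ L * |σ - σ'| := fun k =>
    (hKL (hA4 k) (hW k).1 (hW k).2.1 (hW k).2.2.1 (hW k).2.2.2).2
  -- the gradient floor at the centre: `‖∇v_k(0)(0)‖ > ε`
  have hg0 : ∀ k, ε < ‖fderiv ℝ (v k 0) 0‖ := fun k => by
    have h := zoomN_norm_fderiv_centre (β := β k) (y := y k) (hν k) (hsol k) (ht k) (hM k)
      (rfl : R k = ν k / M k) rfl
    rw [h]
    have hM2 : 0 < M k ^ 2 := pow_pos (hM k) 2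
    rw [div_mul_eq_mul_div, lt_div_iff₀ hM2]
    exact hgrad k
  -- the gradient floor at the interior time `σ₀`
  set σ₀ : ℝ := -min (1 / 2) (ε / (4 * (L + 1))) with hσ₀def
  have hmin0 : 0 < min (1 / 2 : ℝ) (ε / (4 * (L + 1))) := lt_min (by norm_num) (by positivity)
  have hσ₀ : σ₀ ∈ Ico (-1 : ℝ) 0 := by
    refine ⟨?_, by linarith⟩
    have : min (1 / 2 : ℝ) (ε / (4 * (L + 1))) ≤ 1 / 2 := min_le_left _ _
    linarith
  have hLσ₀ : L * |σ₀| ≤ ε / 4 := by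
    rw [hσ₀def, abs_neg, abs_of_pos hmin0]
    calc L * min (1 / 2 : ℝ) (ε / (4 * (L + 1))) ≤ L * (ε / (4 * (L + 1))) :=
          mul_le_mul_of_nonneg_left (min_le_right _ _) hL0
      _ ≤ (L + 1) * (ε / (4 * (L + 1))) :=
          mul_le_mul_of_nonneg_right (by linarith) (by positivity)
      _ = ε / 4 := by field_simp
  have hfloor : ∀ k, ε / 2 < ‖fderiv ℝ (v k σ₀) 0‖ := fun k => by
    have hcont : Tendsto (fun σ => fderiv ℝ (v k σ) 0) (𝓝[<] 0) (𝓝 (fderiv ℝ (v k 0) 0)) :=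
      (zoomN_continuousAt_fderiv (R := R k) (α := α k) (β := β k) (y := y k) (hsol k)
        (ht k)).tendsto.mono_left nhdsWithin_le_nhds
    have h1 : ‖fderiv ℝ (v k σ₀) 0 - fderiv ℝ (v k 0) 0‖ ≤ L * |σ₀| :=
      norm_sub_le_of_lipschitz_of_tendsto (D := fun σ => fderiv ℝ (v k σ) 0) hσ₀
        (fun σ hσ σ' hσ' => hLip k σ hσ σ' hσ' 0) hcont
    have h2 : ‖fderiv ℝ (v k 0) 0‖ ≤
        ‖fderiv ℝ (v k σ₀) 0‖ + ‖fderiv ℝ (v k σ₀) 0 - fderiv ℝ (v k 0) 0‖ := by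
      have := norm_sub_le (fderiv ℝ (v k σ₀) 0) (fderiv ℝ (v k σ₀) 0 - fderiv ℝ (v k 0) 0)
      rwa [sub_sub_cancel] at this
    linarith [hg0 k]
  -- directions of near-maximal stretch, and the oscillation floor
  choose e he1 he2 using fun k =>
    exists_unit_lt_norm_apply (fderiv ℝ (v k σ₀) 0) (by positivity : (0 : ℝ) ≤ ε / 2) (hfloor k)
  set h₁ : ℝ := min 1 (ε / (4 * (K + 1))) with hh₁def
  have hh₁ : 0 < h₁ := lt_min one_pos (by positivity)
  have hKh : K * h₁ ≤ ε / 4 := by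
    calc K * h₁ ≤ K * (ε / (4 * (K + 1))) := mul_le_mul_of_nonneg_left (min_le_right _ _) hK0
      _ ≤ (K + 1) * (ε / (4 * (K + 1))) :=
          mul_le_mul_of_nonneg_right (by linarith) (by positivity)
      _ = ε / 4 := by field_simp
  have hσ₀A : ∀ k, σ₀ ∈ Ioo (A k) 0 := fun k => ⟨by linarith [hA4 k, hσ₀.1], hσ₀.2⟩
  have hosc : ∀ k, h₁ * (ε / 4) ≤ ‖v k σ₀ (h₁ • e k) - v k σ₀ 0‖ := fun k => by
    have hsm : ContDiff ℝ 2 (v k σ₀) :=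
      zoomN_contDiff_slice (y := y k) (hν k) (hsol k) (ht k) (hM k) (rfl : R k = ν k / M k) rfl rfl
        (hσ₀A k)
    have hLipx : ∀ z, ‖fderiv ℝ (v k σ₀) z - fderiv ℝ (v k σ₀) 0‖ ≤ K * ‖z‖ := fun z => by
      simpa only [sub_zero] using norm_fderiv_sub_le_of_iteratedFDeriv_two hsm (hD2 k σ₀ hσ₀) z 0
    have hT := taylor_lower_bound (hsm.differentiable (by simp)) hK0 hLipx hh₁ (he1 k).le
    have h3 : h₁ * (ε / 2) < h₁ * ‖fderiv ℝ (v k σ₀) 0 (e k)‖ :=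
      mul_lt_mul_of_pos_left (he2 k) hh₁
    have h4 : K * h₁ ^ 2 ≤ h₁ * (ε / 4) := by
      rw [sq, ← mul_assoc, mul_comm]
      exact mul_le_mul_of_nonneg_left hKh hh₁.le
    linarith
  -- a subsequence with convergent directions
  obtain ⟨e₀, -, ψ, hψ, hlim⟩ := (isCompact_sphere (0 : EuclideanSpace ℝ (Fin 3)) 1).tendsto_subseq
    (fun k => mem_sphere_zero_iff_norm.2 (he1 k))
  -- extraction (KNSS Lemma 6.1)
  obtain ⟨φ, W, hφ, hWc, hWdiv, hWb, hWmild, -, hpt, hloc⟩ :=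
    KNSS2009_lemma61_oseenMild (A := fun j => A (ψ j)) (w := fun j => v (ψ j)) (C := 1)
      (hAlim.comp hψ.tendsto_atTop) (fun j => (hW (ψ j)).1) (fun j => (hW (ψ j)).2.1)
      (fun j => (hW (ψ j)).2.2.1) (fun j => (hW (ψ j)).2.2.2)
  have hWcont : ∀ τ < 0, Continuous (W τ) := fun τ hτ =>
    hWc.comp_continuous (f := fun x => (τ, x)) (by fun_prop) fun x => ⟨hτ, mem_univ _⟩
  refine ⟨W, isBoundedAncientMildSolution_of_oseen one_pos hWc ⟨1, hWb⟩ hWdiv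
    (fun s τ hs hτ x => by rw [one_mul]; exact hWmild s τ hs hτ x),
    fun τ hτ => (hWcont τ hτ).aestronglyMeasurable, σ₀, hσ₀.2, ?_⟩
  -- the slice `W(σ₀)` takes two values
  have hl1 : Tendsto (fun j => v (ψ (φ j)) σ₀ (h₁ • e (ψ (φ j)))) atTop (𝓝 (W σ₀ (h₁ • e₀))) :=
    (hloc σ₀ hσ₀.2).tendsto_comp (hWcont σ₀ hσ₀.2).continuousAt
      ((hlim.comp hφ.tendsto_atTop).const_smul h₁)
  have hl2 : Tendsto (fun j => v (ψ (φ j)) σ₀ 0) atTop (𝓝 (W σ₀ 0)) := hpt σ₀ hσ₀.2 0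
  have hge : h₁ * (ε / 4) ≤ ‖W σ₀ (h₁ • e₀) - W σ₀ 0‖ :=
    ge_of_tendsto' ((hl1.sub hl2).norm) fun j => hosc (ψ (φ j))
  rintro ⟨b, hb⟩
  have hconst : W σ₀ = fun _ => b :=
    (Continuous.ae_eq_iff_eq volume (hWcont σ₀ hσ₀.2) continuous_const).1 hb
  rw [hconst, sub_self, norm_zero] at hge
  have : 0 < h₁ * (ε / 4) := by positivity
  linarith

end Summit.NavierStokesRegularity.NavierStokesRegularity.Theorems.RootDecompLiouvilleHorizonHorizonCompactness

end
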